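import Literature.Probability.RandomPlanarGeometry.HexSAWBrickWallStripFugacityLevel0
import Literature.Probability.RandomPlanarGeometry.HexSAWBrickWallStripFugacityLevel0Prop6
import Mathlib.Analysis.SpecificLimits.Basic
import HarnessLib

/-!
# BBdGDCG 2014 Corollary 8 for the zig-zag strips (the `C`-part): `Σ_n C_{T,n}(y,1) xⁿ` converges EXACTLY for `x < ρ_T(y) := μ_T(y,1)⁻¹`,
# and `ρ_T(y)` is non-increasing in the fugacity

Topic `Literature/Probability/RandomPlanarGeometry` (lane «pcv-sawmu»; zig-zag TWIN of `HexSAWBrickWallSlabFugacityRadius.lean` (a-p6 g14,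
Beaton's rotated strips), offered to the a-idea-1 strip lineage; rider on `HexSAWBrickWallStripFugacityLevel0.lean` — `HexBW.stripZ₀ T n y
= C_{T,n}(y,1)` with the PRINTED one-level weight, `HexBW.stripMuY₀ T y = μ_T(y,1)`, `HexBW.tendsto_stripZ₀_rpow`, `HexBW.pow_stripMuY₀_le` — and
`HexSAWBrickWallStripFugacityLevel0Prop6.lean` (`HexBW.stripMuY₀_mono_y`); the clause «ρ_T decreasing in T» is one line from
`HexBW.stripMuY₀_lt_succ` of `HexSAWBrickWallStripFugacityLevel0Strict.lean`, whose olean is not built at the time of writing — left to a rider).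

Source.  N. R. Beaton, M. Bousquet-Mélou, J. de Gier, H. Duminil-Copin, A. J. Guttmann, *The critical fugacity for surface adsorption of
self-avoiding walks on the honeycomb lattice is `1+√2`*, Comm. Math. Phys. 326 (2014), arXiv:1109.0358v5, §3.2, Corollary 8 (p. 12; held
corpus text `paper:arxiv-1109.0358` chunk 8 ll. 60–80): "… the properties of `ρ_T(y) := 1/μ_T(1,y)`, which is the radius of convergence of the
series `C_T(x,y) := Σ_{n≥0} C_{T,n}(1,y) xⁿ` counting walks in a strip that interact with the top boundary, and of the analogous series
`A_T(x,y)` and `B_T(x,y)` that count arches and bridges.  Corollary 8. Let `y > 0`. The `A_T(x,y)`, `B_T(x,y)` and `C_T(x,y)` all have the same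
radius of convergence, `ρ_T(y) = 1/μ_T(1,y)`. Moreover, `ρ_T(y)` decreases to `ρ(y) := 1/μ(y)` as `T` goes to infinity. …"  Treated here: the
`C`-clause, and — from Proposition 6's "non-decreasing in `y`" (NOT a clause of Corollary 8, whose "decreases" is in `T`) — the
monotonicity of `ρ_T(y)` in `y`; NOT treated: the monotonicity in `T` (see above), the `A_T`/`B_T` clauses (no strip arch/bridge series with the one-level
weight in the tree at this level), the limit `ρ_T(y) → ρ(y)` (Proposition 7's convergence, `HexSAWStripSurfaceLimit.lean`) and the `y_T`
sentences (the lane's THRESHOLD modules).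

Frame.  `HexBW.stripMuY₀ T y` is `μ_T(y,1)` for the row strip `S_T` of the brick wall with the printed one-level surface weight; the printed
`μ_T(1,y)` equals `μ_T(y,1)` by Proposition 6's symmetry (tree `HexBW.stripMuY₂_symm`, not imported).  Radius in the elementary two-sided form
(no `def`): CONVERGENCE for `0 ≤ x`, `x μ_T(y,1) < 1`; DIVERGENCE for `x μ_T(y,1) ≥ 1` (on the circle too: the terms are `≥ 1/max(1,y⁻¹)`).

## What is proved (namespace `Literature.Probability.RandomPlanarGeometry.SAW.HexBW`; every `T`, `y > 0`)

* `eventually_stripZ₀_le_pow`, `div_pow_le_stripZ₀`;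
* **`summable_stripZ₀_mul_pow`**, **`not_summable_stripZ₀_mul_pow`**, **`summable_stripZ₀_mul_pow_iff`** — `Summable ↔ x < μ_T(y,1)⁻¹` (`0 ≤ x`);
* `inv_stripMuY₀_antitoneOn` — `ρ_T` non-increasing in `y`; `inv_stripMuY₀_pos_le_one` (`T ≥ 1`).

LABEL (author's proposal): CONSOLIDATION AS PRINTED (XS) of Corollary 8's `C`-clause, plus Proposition 6's fugacity monotonicity read on the radius; device = root test on the tree's
Fekete limit; the twin for Beaton's rotated strips is `HexSAWBrickWallSlabFugacityRadius.lean`.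
EDITION ed.2 (docstring-only; code identical to ed.1 `26a909fe6ce3e403`): the attribution of the `y`-monotonicity corrected to Proposition 6
(referee ref g53 §91.6, 2026-08-24).
-/

noncomputable section

open Filter Finset
open _root_.Topology
open Literature.Probability.LatticeModels

namespace Literature.Probability.RandomPlanarGeometry.SAW.HexBW

variable {T : ℕ} {y x r : ℝ}

/-! ### The two sides of the root test -/

/-- **Inner side**: if `μ_T(y,1) < r` then `C_{T,n}(y,1) ≤ rⁿ` for all large `n` (`C_{T,n}^{1/n} → μ_T`).
[cite: BeatonBousquetMelouDeGierDuminilCopinGuttmann2014, §3.2, Proposition 6 and Corollary 8 (arXiv v5 pp. 10–12)] -/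
theorem eventually_stripZ₀_le_pow (hy : 0 < y) (hr : stripMuY₀ T y < r) :
    ∀ᶠ n : ℕ in atTop, stripZ₀ T n y ≤ r ^ n := by
  have hr0 : 0 < r := (stripMuY₀_pos T hy).trans hr
  filter_upwards [(tendsto_stripZ₀_rpow T hy).eventually (gt_mem_nhds hr), eventually_ge_atTop 1] with n hn hn1
  have h0 : 0 ≤ stripZ₀ T n y := (stripZ₀_pos T n hy).le
  have hn0 : (n : ℝ) ≠ 0 := by exact_mod_cast (show n ≠ 0 by omega)
  have h := pow_le_pow_left₀ (Real.rpow_nonneg h0 _) hn.le n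
  rwa [one_div, Real.rpow_inv_natCast_pow h0 (by omega)] at h

/-- **Outer side, for ALL `n`**: `μ_T(y,1)ⁿ / max(1,y⁻¹) ≤ C_{T,n}(y,1)` (the super-multiplicative half of Fekete, tree `pow_stripMuY₀_le`).
[cite: BeatonBousquetMelouDeGierDuminilCopinGuttmann2014, §3.2, Proposition 6 (arXiv v5 p. 10); MadrasSlade1993, Lemma 1.2.2 (p. 9)] -/
theorem div_pow_le_stripZ₀ (hy : 0 < y) (n : ℕ) : stripMuY₀ T y ^ n / yK y ≤ stripZ₀ T n y := by
  have hK : 0 < yK y := lt_of_lt_of_le one_pos (one_le_yK y)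
  rw [div_le_iff₀ hK, mul_comm]
  exact pow_stripMuY₀_le T n hy (stripMuY₀_pos T hy).le

/-! ### Corollary 8, `C`-part: the radius of `Σ_n C_{T,n}(y,1) xⁿ` is `μ_T(y,1)⁻¹` -/

/-- **Convergence inside the radius**: `0 ≤ x`, `x · μ_T(y,1) < 1 ⇒ Σ_n C_{T,n}(y,1) xⁿ < ∞`.
[cite: BeatonBousquetMelouDeGierDuminilCopinGuttmann2014, §3.2, Corollary 8 (arXiv v5 p. 12: "ρ_T(y) := 1/μ_T(1,y), which is the radius of convergence of the series C_T(x,y)")] -/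
theorem summable_stripZ₀_mul_pow (hy : 0 < y) (hx : 0 ≤ x) (h : x * stripMuY₀ T y < 1) :
    Summable fun n : ℕ => stripZ₀ T n y * x ^ n := by
  rcases hx.eq_or_lt with rfl | hx0
  · refine summable_of_ne_finset_zero (s := {0}) fun n hn => ?_
    rw [Finset.mem_singleton] at hn
    simp [zero_pow hn]
  obtain ⟨q, hq1, hq2⟩ := exists_between h
  have hq0 : 0 < q := (mul_pos hx0 (stripMuY₀_pos T hy)).trans hq1
  have hμr : stripMuY₀ T y < q / x := by rwa [lt_div_iff₀ hx0, mul_comm]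
  refine Summable.of_norm_bounded_eventually_nat (summable_geometric_of_lt_one hq0.le hq2) ?_
  filter_upwards [eventually_stripZ₀_le_pow hy hμr] with n hn
  rw [Real.norm_of_nonneg (mul_nonneg (stripZ₀_pos T n hy).le (pow_nonneg hx n))]
  calc stripZ₀ T n y * x ^ n ≤ (q / x) ^ n * x ^ n := mul_le_mul_of_nonneg_right hn (pow_nonneg hx n)
    _ = q ^ n := by rw [← mul_pow, div_mul_cancel₀ q hx0.ne']

/-- **Divergence on and outside the radius**: `1 ≤ x · μ_T(y,1) ⇒ Σ_n C_{T,n}(y,1) xⁿ = ∞` — the terms are `≥ 1/max(1,y⁻¹)`, so they do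
not tend to `0` (this includes the circle `x = ρ_T(y)` itself). [cite: BeatonBousquetMelouDeGierDuminilCopinGuttmann2014, §3.2, Corollary 8 (arXiv v5 p. 12)] -/
theorem not_summable_stripZ₀_mul_pow (hy : 0 < y) (hx : 0 ≤ x) (h : 1 ≤ x * stripMuY₀ T y) :
    ¬ Summable fun n : ℕ => stripZ₀ T n y * x ^ n := by
  intro hs
  have hK : 0 < yK y := lt_of_lt_of_le one_pos (one_le_yK y)
  have h1 : ∀ n : ℕ, (yK y)⁻¹ ≤ stripZ₀ T n y * x ^ n := fun n => by
    calc (yK y)⁻¹ = 1 / yK y := (one_div _).symm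
      _ ≤ (x * stripMuY₀ T y) ^ n / yK y := div_le_div_of_nonneg_right (one_le_pow₀ h) hK.le
      _ = stripMuY₀ T y ^ n / yK y * x ^ n := by rw [mul_pow]; ring
      _ ≤ stripZ₀ T n y * x ^ n := mul_le_mul_of_nonneg_right (div_pow_le_stripZ₀ hy n) (pow_nonneg hx n)
  have h2 : ∀ᶠ n : ℕ in atTop, stripZ₀ T n y * x ^ n < (yK y)⁻¹ :=
    hs.tendsto_atTop_zero.eventually (gt_mem_nhds (inv_pos.2 hK))
  obtain ⟨n, hn⟩ := h2.exists
  exact absurd hn (not_lt.2 (h1 n))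

/-- **Corollary 8 (`C`-part) for the zig-zag strips: the radius of convergence of `Σ_n C_{T,n}(y,1) xⁿ` IS `ρ_T(y) = μ_T(y,1)⁻¹`** —
for `0 ≤ x`, the series converges iff `x < μ_T(y,1)⁻¹`.
[cite: BeatonBousquetMelouDeGierDuminilCopinGuttmann2014, §3.2, Corollary 8 (arXiv v5 p. 12: "all have the same radius of convergence, ρ_T(y) = 1/μ_T(1,y)")] -/
theorem summable_stripZ₀_mul_pow_iff (hy : 0 < y) (hx : 0 ≤ x) :
    (Summable fun n : ℕ => stripZ₀ T n y * x ^ n) ↔ x < (stripMuY₀ T y)⁻¹ := by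
  have hμ := stripMuY₀_pos T hy
  constructor
  · intro hs
    by_contra hle
    rw [not_lt] at hle
    have h1 : 1 ≤ x * stripMuY₀ T y := by
      calc (1 : ℝ) = (stripMuY₀ T y)⁻¹ * stripMuY₀ T y := by rw [inv_mul_cancel₀ hμ.ne']
        _ ≤ x * stripMuY₀ T y := mul_le_mul_of_nonneg_right hle hμ.le
    exact not_summable_stripZ₀_mul_pow hy hx h1 hs
  · intro hlt
    refine summable_stripZ₀_mul_pow hy hx ?_
    calc x * stripMuY₀ T y < (stripMuY₀ T y)⁻¹ * stripMuY₀ T y := mul_lt_mul_of_pos_right hlt hμ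
      _ = 1 := inv_mul_cancel₀ hμ.ne'

/-! ### Corollary 8, monotonicity clause in the fugacity -/

/-- **`y ↦ ρ_T(y)` is non-increasing on `(0, ∞)`** (Proposition 6's monotonicity in the fugacity).
[cite: BeatonBousquetMelouDeGierDuminilCopinGuttmann2014, §3.2, Proposition 6 and Corollary 8 (arXiv v5 pp. 10–12)] -/
theorem inv_stripMuY₀_antitoneOn : AntitoneOn (fun y : ℝ => (stripMuY₀ T y)⁻¹) (Set.Ioi 0) :=
  fun _ hy _ _ hyy' => inv_anti₀ (stripMuY₀_pos T hy) (stripMuY₀_mono_y T hy hyy')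

/-- **The radius lies in `(0, 1]` for `T ≥ 1`** (`μ_T(y,1) ≥ 1` there, tree `one_le_stripMuY₀`).
[cite: BeatonBousquetMelouDeGierDuminilCopinGuttmann2014, §3.2, Corollary 8 (arXiv v5 p. 12)] -/
theorem inv_stripMuY₀_pos_le_one (hT : 1 ≤ T) (hy : 0 < y) : 0 < (stripMuY₀ T y)⁻¹ ∧ (stripMuY₀ T y)⁻¹ ≤ 1 :=
  ⟨inv_pos.2 (stripMuY₀_pos T hy), inv_le_one_of_one_le₀ (one_le_stripMuY₀ hT hy)⟩

end Literature.Probability.RandomPlanarGeometry.SAW.HexBW
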